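import Summits.NavierStokesRegularity.NavierStokesRegularity.Theorems.StrainDoorsSliceVorticityFloor
import Summits.NavierStokesRegularity.NavierStokesRegularity.Theorems.StrainDoorsDoorXClosed
import HarnessLib

/-!
# Strain doors, PART M §M32(e) — door Y∞ CLOSED (door X is closed, ROUND 70); Barker–Prange (5.3) made
# quantitative and `M`-only

ROUND 71 of the `ns-regularity-ideate` p1 line (helper lane of `stmt-NavierStokesRegularity-0056`, rung N0;
nothing here is a claim about Navier–Stokes regularity — a-priori STRUCTURE of a HYPOTHETICAL singularity of a
solution which is Type I in the sup-norm; nothing about Type II).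

PART M §M32 — door **Y∞**: at a singular point `(T,x₀)` of a classical Leray–Hopf solution with the global
sup-norm Type-I bound `|u| ≤ M/√(T − t)`, for ALL `t` close to `T` the parabolic ball `B(x₀, R(M)√(T − t))`
contains a point with `(T − t)|ω(x,t)| ≥ d(M)` — constants depending on `M` ONLY (the quantitative, `M`-only,
every-time form of Barker–Prange 2020 (5.3), and the non-vacuity half of the `δ₀`-criterion of ROUNDS 68/70).
Mechanism: bad slices ⇒ zoom with the slice placed at `−4q²` (§M32(a)) ⇒ `U ∈ A_M` with small vorticity on a
large ball at `−4q²` AND — door X (ROUND 70, `M`-only every-time `L³` concentration) at the rescaled time `−2`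
— definite `L³` mass at `−2` ⇒ second compactness in `A_M` ⇒ `W` with `curl W(−4q²) ≡ 0` ⇒ `W(−4q²) ≡ c`
(curl-free Liouville) ⇒ LEMMA F (§M32(b), forward uniqueness of a constant slice in `A_M`) `W(−2) ≡ c`,
`|c| ≤ M/(2q)` ⇒ mass `|c|³·|B̄| < γ(M)` for `q = q(M)`: contradiction (§M32(c)–(d)).

THIS FILE (text N12c): `sliceVorticityFloorSupTypeI_holds : SliceVorticityFloorSupTypeI` (= §M32(d) applied to
ROUND 70's `sliceL3Concentration_holds`) and `sliceVorticityFloor_along` (along every sequence of times `s_n → T`: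
eventually a point of `B(x₀,R√(T − s_n))` has `|ω(·,s_n)| ≥ d/(T − s_n)`, hence `> d'` for any fixed `d'`).
Imports ROUND 70 text N11h `StrainDoorsDoorXClosed` (lands after it).  No `sorry`, no new axioms, no definitions.
-/

noncomputable section
set_option linter.dupNamespace false
open MeasureTheory Set Function Filter Metric Real InnerProductSpace
open _root_.Topology
open scoped ENNReal NNReal RealInnerProductSpace ContDiff
open Literature.Analysis Literature.Analysis.FluidPDE Literature.Analysis.FluidPDE.LocalTypeIBlowup

namespace Summit.NavierStokesRegularity.NavierStokesRegularity.Theorems.StrainDoors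

/-! ### §M32(e) Door Y∞ closed (door X is closed, ROUND 70) and Barker–Prange (5.3) made quantitative -/

/-- ★★★★ **DOOR Y∞ CLOSED: THE `M`-ONLY SIMILARITY-SCALE VORTICITY FLOOR AT SUP-TYPE-I SINGULAR POINTS.**
For every `M` there are `R(M), d(M) > 0` such that at a singular point `(T,x₀)` of a classical Leray–Hopf
solution on `[0,T)` with `|u| ≤ M/√(T − t)`: for all `t < T` close to `T` some `x ∈ B(x₀, R√(T − t))` has
`(T − t)|ω(x,t)| ≥ d`.  `= sliceVorticityFloorSupTypeI_of_sliceL3Concentration sliceL3Concentration_holds`.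
(Nearest print: Barker–Prange 2020 (5.3) along the blow-up sequence with solution-dependent constants; the
every-time local enstrophy floor under the `L^{3,∞}` Type-I bound, Barker–Prange 2021 §1.3 p. 6.)
[cite: BarkerPrange2020Alignment, Thm 1 and (5.3) (arXiv:1906.08225 pp. 16–18); BarkerPrange2021, §1.3
(arXiv:2003.06717 p. 6); BarkerPrange2020, Thm 2] -/
theorem sliceVorticityFloorSupTypeI_holds : SliceVorticityFloorSupTypeI :=
  sliceVorticityFloorSupTypeI_of_sliceL3Concentration sliceL3Concentration_holds

/-- ★★ **COROLLARY (Barker–Prange (5.3), quantitative and `M`-only): ALONG EVERY SEQUENCE OF TIMES.**  With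
`R(M)`, `d(M)` of the door Y∞: at a singular point of a classical Leray–Hopf solution with the global sup-norm
Type-I bound `M`, for every sequence `s_n → T` in `(0,T)`, EVENTUALLY `B(x₀, R√(T − s_n))` contains a point
with `|ω(·,s_n)| ≥ d/(T − s_n)`; in particular for every fixed threshold `d'` the superlevel set
`{|ω(·,s_n)| > d'} ∩ B(x₀, R√(T − s_n))` is non-empty for all large `n` (the non-vacuity of the hypothesis of
`sliceAligned_fixedDelta_not_singular_of_supTypeI_M_only` at a singular point).
[cite: BarkerPrange2020Alignment, (5.3) (arXiv:1906.08225 p. 18)] -/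
theorem sliceVorticityFloor_along (M : ℝ) :
    ∃ R d : ℝ, 0 < R ∧ 0 < d ∧
      ∀ (T : ℝ) (u : ℝ → EuclideanSpace ℝ (Fin 3) → EuclideanSpace ℝ (Fin 3))
        (p : ℝ → EuclideanSpace ℝ (Fin 3) → ℝ), 0 < T →
        IsClassicalNSSolutionOn (Ico 0 T) 1 0 u p → IsLerayHopfOn T 1 0 (u 0) u →
        (∀ t ∈ Ioo 0 T, ∀ x : EuclideanSpace ℝ (Fin 3), ‖u t x‖ ≤ M / Real.sqrt (T - t)) →
        ∀ x₀ : EuclideanSpace ℝ (Fin 3), IsBackwardSingularPoint u (T, x₀) →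
          ∀ s : ℕ → ℝ, (∀ n, s n ∈ Ioo 0 T) → Tendsto s atTop (𝓝 T) →
            (∀ᶠ n in atTop, ∃ x ∈ ball x₀ (R * Real.sqrt (T - s n)), d ≤ (T - s n) * ‖curl (u (s n)) x‖) ∧
            ∀ d' : ℝ, ∀ᶠ n in atTop, ∃ x ∈ ball x₀ (R * Real.sqrt (T - s n)), d' < ‖curl (u (s n)) x‖ := by
  obtain ⟨R, d, hR, hd, hY⟩ := sliceVorticityFloorSupTypeI_holds M
  refine ⟨R, d, hR, hd, ?_⟩
  intro T u p hT hcl hLH hI x₀ hsing s hs hsT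
  obtain ⟨t₁, ht₁, hfloor⟩ := hY T u p hT hcl hLH hI x₀ hsing
  have hev : ∀ᶠ n in atTop, t₁ < s n := hsT.eventually (Ioi_mem_nhds ht₁)
  have h1 : ∀ᶠ n in atTop, ∃ x ∈ ball x₀ (R * Real.sqrt (T - s n)), d ≤ (T - s n) * ‖curl (u (s n)) x‖ := by
    filter_upwards [hev] with n hn
    exact hfloor (s n) ⟨hn, (hs n).2⟩
  refine ⟨h1, fun d' => ?_⟩
  -- `(T - s n) * (|d'| + 1) < d` eventually
  have hsmall : ∀ᶠ n in atTop, (T - s n) * (|d'| + 1) < d := by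
    have hT' : Tendsto (fun n => (T - s n) * (|d'| + 1)) atTop (𝓝 0) := by
      have h : Tendsto (fun n => T - s n) atTop (𝓝 (T - T)) := tendsto_const_nhds.sub hsT
      rw [sub_self] at h
      simpa using h.mul_const (|d'| + 1)
    exact hT'.eventually_lt_const hd
  filter_upwards [h1, hsmall] with n hn hsm
  obtain ⟨x, hx, hdx⟩ := hn
  refine ⟨x, hx, ?_⟩
  by_contra hle
  push Not at hle
  have hTs : 0 ≤ T - s n := by linarith [(hs n).2]
  have h3 : (T - s n) * ‖curl (u (s n)) x‖ ≤ (T - s n) * (|d'| + 1) :=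
    mul_le_mul_of_nonneg_left (hle.trans ((le_abs_self d').trans (by linarith))) hTs
  linarith

end Summit.NavierStokesRegularity.NavierStokesRegularity.Theorems.StrainDoors

end
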